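import Summits.CriticalPhenomena.Ising3DConformalLimit.Theses.CoerciveSharpness
import Summits.CriticalPhenomena.Ising3DConformalLimit.Theorems.LatticeSDPCertificatesWindowBelowHalf
import Summits.CriticalPhenomena.Ising3DConformalLimit.Theorems.PrimaryAtInfinityTwoPointPowerLawEta
import Literature.Probability.LatticeModels.PointwiseScalingLimitScale
import Literature.Probability.LatticeModels.CriticalUrsellFourSign
import Literature.Probability.LatticeModels.HighDimPointwiseTriviality
import Literature.Probability.LatticeModels.IsingExponentsProofs
import Summits.CriticalPhenomena.Ising3DConformalLimit.Theorems.JoinForcesU4.Negative.LoadBearing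
import HarnessLib

/-!
# `WindowForcesU4` (stmt-CriticalPhenomena-5505): load-bearing hypotheses, tightness of the window,
# and what any proof must also prove

Negative knowledge about the crux `…Theses.CoerciveSharpness.WindowForcesU4` (= the shared decl
`…Theses.LatticeSDPCertificates.WindowForcesU4`; its antecedent WINDOW is, verbatim, the support item
`…Theses.LatticeSDPCertificates.WindowBelowHalf`, stmt-CriticalPhenomena-5507), standing crux disprover
(cdisprove, D-0016); supports the item, closes nothing. Companion of `Negative/ModelBlind.lean`.

§1 TIGHTNESS OF THE ANTECEDENT. Any WINDOW witness `(ε, c)` has `c ≤ 1` (`window_const_le_one`, the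
case `m = n`) and `ε ≤ 1/2` (`window_exponent_le_half`: `m = 1` and the infrared bound
`G(n e₁) ≤ C n⁻¹` of `criticalTwoPoint_bounds_holds` give `c G(e₁) n^{ε-1/2} ≤ C`). The room `ε = 1/2`
is attained by the free-field impostor `gffLattice (1/2)` of `ModelBlind.lean` (WINDOW with equality), so
neither inequality can be improved from two-point information.

§2 NON-DEGENERACY IS LOAD-BEARING — EXACTLY TO THE EXTENT THAT WINDOW HOLDS. With
`IsNondegenerateTwoPoint` dropped the crux becomes EQUIVALENT TO THE NEGATION OF ITS OWN ANTECEDENT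
(`windowForcesU4WithoutNondegeneracy_iff_not_window`): the zero family is a genuine pointwise limit of
`criticalCorr 3` under `ρ δ = δ` (`|⟨∏σ⟩| ≤ 1`) with `U₄ ≡ 0` (as in 0636 `Disproof.lean` §A.1, here
imported tree-side from `Theorems/JoinForcesU4/Negative/LoadBearing.lean`, `hasPointwiseScalingLimit_zeroFamily`);
dropping the lattice clause instead gives `¬ WINDOW` too (`windowForcesU4WithoutLimit_iff_not_window`, unit Wick family).

§3 POSITIVITY OF `ρ` IS COSMETIC (`windowForcesU4_iff_withoutPositivity`): odd critical correlators vanish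
and non-degeneracy makes `ρ ≠ 0` eventually, so `|ρ|` serves (`exists_pos_renormalisation`); cf. 0636
`Disproof.lean` §A.3. Dropping WINDOW itself gives crux 0636 (`IsingEuclidUpgradeR4NonGaussian`, open,
two disprover generations without a kill), so no `false_without_window` is available: WINDOW is
ENGINE-bearing (doubling 5508, top-heavy bubble 5509), not truth-bearing.

§4 NECESSITY (what a proof of the crux also proves). From the landed edge-Gaussianity chain
(`twoPointPowerLawEta_of_nonGaussian'`, `etaPos_of_twoPointPowerLawEta`): crux + WINDOW + ONE
non-degenerate pointwise limit `⊢ ¬ HasIsingExponentEta 3 0` (`not_isingExponentEta_zero_of_windowForcesU4`).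
In the scenario `HasIsingEtaBounds 3 0` — the infrared bound sharp up to constants, `c‖x‖⁻¹ ≤ G ≤ C‖x‖⁻¹`,
which FORCES WINDOW with `ε = 1/2` and contradicts no printed bound — the crux asserts that critical Ising₃
has NO non-degenerate pointwise scaling limit under any renormalisation
(`no_nondegenerate_limit_of_windowForcesU4_of_etaBounds_zero`); for the impostor `gffLattice (1/2)` that
scenario is realised WITH such a limit (`ModelBlind.lean`). So the pair (crux, existence item of the route)
carries `¬ HasIsingEtaBounds 3 0` — an improvement of Fröhlich–Simon–Spencer along a subsequence, open.
-/

noncomputable section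

namespace Summit.CriticalPhenomena.Ising3DConformalLimit.WindowForcesU4Negative

open Literature.Probability.LatticeModels Filter Topology
open Summit.CriticalPhenomena.Ising3DConformalLimit.Theses
open Summit.CriticalPhenomena.Ising3DConformalLimit.Theorems
  (norm_single_natCast single_natCast_ne_zero windowBelowHalf_of_hasIsingEtaBounds)
open Summit.CriticalPhenomena.Ising3DConformalLimit.Theorems.PrimaryAtInfinityTwoPointPowerLawEta
  (twoPointPowerLawEta_of_nonGaussian' etaPos_of_twoPointPowerLawEta)
open Summit.CriticalPhenomena.Ising3DConformalLimit.Theorems.JoinForcesU4.Negative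
  (zeroFamily hasPointwiseScalingLimit_zeroFamily not_hasNontrivialU4_zeroFamily wickUnitFamily
    isNondegenerateTwoPoint_wickUnitFamily not_hasNontrivialU4_wickUnitFamily eventually_ne_zero_of_limit)

/-! ## §1 Tightness of the window -/

/-- **Any WINDOW constant is at most `1`** (take `m = n = 1`; `G(e₁) > 0`). [folklore] -/
theorem window_const_le_one {ε c : ℝ}
    (hw : ∀ m n : ℕ, 1 ≤ m → m ≤ n →
      c * ((n : ℝ) / m) ^ (-((3:ℝ) / 2 - ε)) * criticalTwoPoint 3 (Pi.single 0 (m : ℤ)) ≤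
        criticalTwoPoint 3 (Pi.single 0 (n : ℤ))) :
    c ≤ 1 := by
  have h := hw 1 1 le_rfl le_rfl
  have hg := criticalTwoPoint_axis_pos 1
  simp only [Nat.cast_one, div_one, Real.one_rpow, mul_one] at h hg
  exact (mul_le_iff_le_one_left hg).1 h

/-- **Any WINDOW exponent is at most `1/2`**: with `m = 1`, WINDOW gives `c G(e₁) n^{-(3/2-ε)} ≤ G(n e₁)`,
the infrared bound gives `G(n e₁) ≤ C n⁻¹`, so `c G(e₁) n^{ε - 1/2} ≤ C` for all `n ≥ 1`, impossible for
`ε > 1/2`. The extreme room `ε = 1/2` ("`η_eff = 0` at all scales") is consistent with everything in print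
and is realised by the free field read on `ℤ³`. [folklore] -/
theorem window_exponent_le_half {ε c : ℝ} (hc : 0 < c)
    (hw : ∀ m n : ℕ, 1 ≤ m → m ≤ n →
      c * ((n : ℝ) / m) ^ (-((3:ℝ) / 2 - ε)) * criticalTwoPoint 3 (Pi.single 0 (m : ℤ)) ≤
        criticalTwoPoint 3 (Pi.single 0 (n : ℤ))) :
    ε ≤ 1 / 2 := by
  by_contra hε'
  have hε : 1 / 2 < ε := not_le.1 hε'
  obtain ⟨_, C, -, hbd⟩ := criticalTwoPoint_bounds_holds (d := 3) (by norm_num)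
  have hg := criticalTwoPoint_axis_pos 1
  set G₁ := criticalTwoPoint 3 (Pi.single 0 ((1 : ℕ) : ℤ)) with hG₁
  have hbound : ∀ n : ℕ, 1 ≤ n → c * G₁ * (n : ℝ) ^ (ε - 1 / 2) ≤ C := by
    intro n hn
    have hn0 : (0 : ℝ) < n := by exact_mod_cast hn
    have h1 := hw 1 n le_rfl hn
    rw [Nat.cast_one, div_one] at h1
    have h2 := (hbd _ (single_natCast_ne_zero hn)).2
    rw [norm_single_natCast, show (-(((3 : ℕ) : ℝ) - 2)) = (-1 : ℝ) by norm_num] at h2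
    have hsplit : (n : ℝ) ^ (-((3 : ℝ) / 2 - ε)) = (n : ℝ) ^ (ε - 1 / 2) * (n : ℝ) ^ (-1 : ℝ) := by
      rw [← Real.rpow_add hn0]; congr 1; ring
    have h3 : c * G₁ * (n : ℝ) ^ (ε - 1 / 2) * (n : ℝ) ^ (-1 : ℝ) ≤ C * (n : ℝ) ^ (-1 : ℝ) := by
      calc c * G₁ * (n : ℝ) ^ (ε - 1 / 2) * (n : ℝ) ^ (-1 : ℝ)
          = c * (n : ℝ) ^ (-((3 : ℝ) / 2 - ε)) * G₁ := by rw [hsplit]; ring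
        _ ≤ criticalTwoPoint 3 (Pi.single 0 (n : ℤ)) := h1
        _ ≤ C * (n : ℝ) ^ (-1 : ℝ) := h2
    exact le_of_mul_le_mul_right h3 (Real.rpow_pos_of_pos hn0 _)
  have htend : Tendsto (fun n : ℕ => c * G₁ * (n : ℝ) ^ (ε - 1 / 2)) atTop atTop :=
    Tendsto.const_mul_atTop (mul_pos hc hg)
      ((tendsto_rpow_atTop (by linarith)).comp tendsto_natCast_atTop_atTop)
  obtain ⟨n, hn⟩ := ((htend.eventually_gt_atTop C).and (eventually_ge_atTop 1)).exists
  exact absurd (hbound n hn.2) (not_le.2 hn.1)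

/-! ## §2 Non-degeneracy is load-bearing — exactly as much as WINDOW holds -/

/-- **Dropping non-degeneracy turns the crux into `¬ WINDOW`** (the negation of its own antecedent, item
stmt-CriticalPhenomena-5507, physically expected TRUE with `ε = 1/2 - η ≈ 0.46`): non-degeneracy of `S₂`
is load-bearing in exactly the measure that WINDOW holds. [folklore] -/
theorem windowForcesU4WithoutNondegeneracy_iff_not_window :
    (LatticeSDPCertificates.WindowBelowHalf → ∀ (ρ : ℝ → ℝ) (S : CorrFamily 3),
      (∀ δ ∈ Set.Ioc (0:ℝ) 1, 0 < ρ δ) → HasPointwiseScalingLimit (criticalCorr 3) ρ S → HasNontrivialU4 S) ↔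
    ¬ LatticeSDPCertificates.WindowBelowHalf :=
  ⟨fun h hW => not_hasNontrivialU4_zeroFamily
      (h hW (fun δ => δ) zeroFamily (fun _ hδ => hδ.1) hasPointwiseScalingLimit_zeroFamily),
    fun hn hW => absurd hW hn⟩

/-- **Dropping the lattice clause also gives `¬ WINDOW`** (witness: the unit Wick family `S₂ ≡ 1`,
`S₄ ≡ 3`): trivially, the conclusion is about limits OF ISING, not about families. [folklore] -/
theorem windowForcesU4WithoutLimit_iff_not_window :
    (LatticeSDPCertificates.WindowBelowHalf → ∀ S : CorrFamily 3, IsNondegenerateTwoPoint S → HasNontrivialU4 S) ↔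
    ¬ LatticeSDPCertificates.WindowBelowHalf :=
  ⟨fun h hW => not_hasNontrivialU4_wickUnitFamily (h hW wickUnitFamily isNondegenerateTwoPoint_wickUnitFamily),
    fun hn hW => absurd hW hn⟩

/-! ## §3 Positivity of the renormalisation is cosmetic -/

/-- **Positivity of `ρ` is cosmetic**: the crux is equivalent to its sign-free form (odd critical correlators
vanish, `m*(β_c) = 0` for `d = 3`, and `ρ ≠ 0` eventually by non-degeneracy, so `|ρ|` is an admissible
positive renormalisation with the same limit; cf. `JoinForcesU4.Negative.iff_withoutPositivity`). A refuter
gains nothing from exotic `ρ`. [folklore] -/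
theorem windowForcesU4_iff_withoutPositivity : CoerciveSharpness.WindowForcesU4 ↔
    (LatticeSDPCertificates.WindowBelowHalf → ∀ (ρ : ℝ → ℝ) (S : CorrFamily 3),
      HasPointwiseScalingLimit (criticalCorr 3) ρ S → IsNondegenerateTwoPoint S → HasNontrivialU4 S) := by
  refine ⟨fun h hW ρ S hlim hnd => ?_, fun h hW ρ S _ hlim hnd => h hW ρ S hlim hnd⟩
  obtain ⟨ρ', hρ', hlim'⟩ := hlim.exists_pos_renormalisation
    (fun n hn y => criticalCorr_eq_zero_of_odd le_rfl hn y) (eventually_ne_zero_of_limit hlim hnd)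
  exact h hW ρ' S (fun δ _ => hρ' δ) hlim' hnd

/-! ## §4 Necessity: the crux, the window and one non-degenerate limit exclude `η = 0` -/

/-- **Any proof of the crux proves `η ≠ 0` (logarithmic sense) from WINDOW and ONE non-degenerate pointwise
limit**: the crux makes every such limit non-Gaussian, the landed edge-Gaussianity chain
(`twoPointPowerLawEta_of_nonGaussian'`, `etaPos_of_twoPointPowerLawEta`) turns that into `η > 0` for every
existing exponent `η`. [folklore] -/
theorem not_isingExponentEta_zero_of_windowForcesU4 {ρ : ℝ → ℝ} {S : CorrFamily 3}
    (h : CoerciveSharpness.WindowForcesU4) (hW : LatticeSDPCertificates.WindowBelowHalf)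
    (hρ : ∀ δ ∈ Set.Ioc (0:ℝ) 1, 0 < ρ δ) (hlim : HasPointwiseScalingLimit (criticalCorr 3) ρ S)
    (hnd : IsNondegenerateTwoPoint S) : ¬ HasIsingExponentEta 3 0 := fun h0 =>
  lt_irrefl (0 : ℝ)
    (etaPos_of_twoPointPowerLawEta
      (twoPointPowerLawEta_of_nonGaussian' fun ρ S hρ hlim hnd => h hW ρ S hρ hlim hnd) hρ hlim hnd h0)

/-- **In the infrared-edge scenario `HasIsingEtaBounds 3 0` (`c‖x‖⁻¹ ≤ G ≤ C‖x‖⁻¹`, which forces WINDOW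
with `ε = 1/2`) the crux says critical Ising₃ has NO non-degenerate pointwise scaling limit at all.** For
the free-field impostor `gffLattice (1/2)` (`Negative/ModelBlind.lean`) this very scenario holds WITH such a
limit; and together with the route's existence item the crux therefore carries `¬ HasIsingEtaBounds 3 0`.
[folklore] -/
theorem no_nondegenerate_limit_of_windowForcesU4_of_etaBounds_zero {ρ : ℝ → ℝ} {S : CorrFamily 3}
    (h : CoerciveSharpness.WindowForcesU4) (h0 : HasIsingEtaBounds 3 0)
    (hρ : ∀ δ ∈ Set.Ioc (0:ℝ) 1, 0 < ρ δ) (hlim : HasPointwiseScalingLimit (criticalCorr 3) ρ S) :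
    ¬ IsNondegenerateTwoPoint S := fun hnd =>
  not_isingExponentEta_zero_of_windowForcesU4 h
    (windowBelowHalf_of_hasIsingEtaBounds (by norm_num) h0) hρ hlim hnd
    (HasIsingEtaBounds.hasIsingExponentEta' h0)

/-- Equivalently: **crux ⊢ (existence of a non-degenerate limit) → the infrared bound is NOT sharp two-sidedly**.
[folklore] -/
theorem not_etaBounds_zero_of_windowForcesU4_of_limit (h : CoerciveSharpness.WindowForcesU4)
    (hex : ∃ (ρ : ℝ → ℝ) (S : CorrFamily 3), (∀ δ ∈ Set.Ioc (0:ℝ) 1, 0 < ρ δ) ∧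
      HasPointwiseScalingLimit (criticalCorr 3) ρ S ∧ IsNondegenerateTwoPoint S) :
    ¬ HasIsingEtaBounds 3 0 := fun h0 => by
  obtain ⟨ρ, S, hρ, hlim, hnd⟩ := hex
  exact no_nondegenerate_limit_of_windowForcesU4_of_etaBounds_zero h h0 hρ hlim hnd

end Summit.CriticalPhenomena.Ising3DConformalLimit.WindowForcesU4Negative
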